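import Mathlib
import HarnessLib
import Summits.HubbardSuperconductivity.HubbardSuperconductivity.Theorems.KLProgrammeKLRegimeEngineV8GridLiteralsPkg
import Summits.HubbardSuperconductivity.HubbardSuperconductivity.Theorems.KLProgrammeKLRegimeEngineV8TowerCoreDefsCG

/-!
# Route `KLProgramme` — ENGINE child gen 8 (stmt-HubbardSuperconductivity-20437 `KLRegimeEngineV17F2`): the «(b)-GRID-DEFERRED» docket literals and token #28 AT A
# GEOMETRY SLOT `G` — registrant PRESTAGE for the post-FREEZE G-token motion «AMENDMENT 24 — (c)-OUT» (plan g23 (R237)/(R243): `klEngGeo11 ↦ klEngGeo13`; candidate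
# successor `klEngGeo14`, AMENDMENT 24+25 (R257)); cell gate-hubbard-kl, seat gate-hubbard-kl-p1b g16 (20437 v2 registrant lineage)

WHY.  `…EngineV8GridLiteralsPkg` (D2‴ of the v8.30 FREEZE text, p661328) keys the deferred grid-literal package at the image's keys `(klEngQ7 P R, klEngGeo11)`:
the literals `klZt / klZs1 / klZs2 P R`, the producer thresholds `klGridLitUAt / klGridLitCAt P R` and token #28 `klEngC₃7 P R` (whose min-chain reads `klZs1 P R`,
`klTowerCoreCC9 P R`, `klGridLitCAt P R` — all `klEngGeo11`-keyed).  The producer statement `TwoLegGridMomentsStepCT P R Q₀ G z u cG` consumes the public history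
`HistP klPredsV17F2 L M G …` at the image's G token, so a G-token motion of the image (AMENDMENT 24; all seven rows move) needs the same objects keyed at the successor
token.  The G-GENERIC package `klGridLitPkg P R Q₀ G` is already in D2‴; this file only names its projections, thresholds and the #28 min-chain with `G` as an explicit
PARAMETER (one text for `klEngGeo13` / `klEngGeo14` / any later successor), each equal to the frozen object at `G := klEngGeo11` by `rfl`:
* §1 literals **`klZtG / klZs1G / klZs2G G P R`**, rows `klZtG_base`, `klZs1G_nonneg`, `klZs2G_base` (the §C n = 0 rows), thresholds **`klGridLitUAtG G P R Q cc`**,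
  **`klGridLitCAtG G P R`** (+ `_pos`), the unroll **`twoLegGridFlowMomentsAtC_klZG_of_exists`** (the (b) closer's fifth conjunct at the G-keyed literals), `rfl` rows
  `klZtG_klEngGeo11` … `klGridLitCAtG_klEngGeo11`;
* §2 token #28 at `G`: **`klEngC₃7G G P R := min klEngC₃6 (min cz-row (min log-row (min klTowerCC (min (klTowerCoreCC9G G P R) (klGridLitCAtG G P R)))))`** — D2‴'s chain
  VERBATIM with the two G-keyed entries re-keyed (`klTowerCC P R` of D1 is G-free and stays) — rows `klEngC₃7G_le_klEngC₃6 / _le_cz_row / _le_log_row / _le_klTowerCC /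
  _le_klTowerCoreCC9G / _le_klGridLitCAtG`, `klEngC₃7G_pos G P hR`, `klEngC₃7G_klEngGeo11 : klEngC₃7G klEngGeo11 P R = klEngC₃7 P R` (`rfl`);
* §3 the (e) closer's #28 row from the doors at `G`: `klZs1G_mixedRow_of_doors`.
NOT A MOTION: no token of record moves here (the image's re-render `klEngGeo11 ↦ G'`, `klZt ↦ klZtG G'`, `klEngC₃7 ↦ klEngC₃7G G'`, … is the pen's AMENDMENT 24 with
J/T2/kl-ref legs).  Definitions with bodies + order lemmas; the producer statement is a HYPOTHESIS slot; nothing about the model is asserted; nothing asserts any stub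
of 20437, K3 or superconductivity.
-/

noncomputable section

namespace Summit.HubbardSuperconductivity.HubbardSuperconductivity.Theorems.EngineV8

set_option linter.dupNamespace false -- summit = problem name (single-conjunct summit), D-0017

open Real Finset Literature.MathematicalPhysics.QuantumLattice Literature.Probability.LatticeModels
open Summit.HubbardSuperconductivity.HubbardSuperconductivity.Theorems.KLRegimeSplit
open Summit.HubbardSuperconductivity.HubbardSuperconductivity.Theorems.KLProgrammeLegKernels
open Summit.HubbardSuperconductivity.HubbardSuperconductivity.Theorems.DispersionFlow

/-! ## §1 The docket literals (token #27 family) at the keys `(klEngQ7 P R, G)` and the rows §C reads BY NAME -/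

section Literals

variable (G : GeoConsts) (P : SplitConsts) (R : RenConsts)

/-- **`klZtG G P R`** — the (T′-B) TIME-row literal at the geometry slot `G` (deferred; `= klZtBase0 R` unless the producer statement at `G` holds). -/
def klZtG : ℝ := (klGridLitPkg P R (klEngQ7 P R) G).1.1

/-- **`klZs1G G P R`** — the (T′-B) mixed SPACE-row `ĉ·|U|` literal at `G` (deferred; `= 0` unless the producer statement at `G` holds). -/
def klZs1G : ℝ := (klGridLitPkg P R (klEngQ7 P R) G).1.2.1

/-- **`klZs2G G P R`** — the (T′-B) SPACE-row `U²` literal at `G` (deferred; `= klZs2Base0 R` unless the producer statement at `G` holds). -/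
def klZs2G : ℝ := (klGridLitPkg P R (klEngQ7 P R) G).1.2.2

/-- `klZtG klEngGeo11 P R = klZt P R` (`rfl`: at the frozen token the literal IS D2‴'s). -/
theorem klZtG_klEngGeo11 : klZtG klEngGeo11 P R = klZt P R := rfl

/-- `klZs1G klEngGeo11 P R = klZs1 P R` (`rfl`). -/
theorem klZs1G_klEngGeo11 : klZs1G klEngGeo11 P R = klZs1 P R := rfl

/-- `klZs2G klEngGeo11 P R = klZs2 P R` (`rfl`). -/
theorem klZs2G_klEngGeo11 : klZs2G klEngGeo11 P R = klZs2 P R := rfl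

/-- **§C n = 0 row at `G`**: `2¹⁰·e¹⁸·κ₀⁴·klE3A1 R ≤ klZtG G P R`. -/
theorem klZtG_base : (2 : ℝ) ^ 10 * Real.exp 1 ^ 18 * Real.sqrt (2 * (7 + 1606732)) ^ 4 * klE3A1 R ≤ klZtG G P R :=
  (isGridLitPkg_klGridLitPkg P R (klEngQ7 P R) G).1

/-- **§C n = 0 row at `G`**: `0 ≤ klZs1G G P R`. -/
theorem klZs1G_nonneg : 0 ≤ klZs1G G P R := (isGridLitPkg_klGridLitPkg P R (klEngQ7 P R) G).2.1

/-- **§C n = 0 row at `G`**: `2¹¹·e¹⁸·κ₀⁴·klE3A1 R ≤ klZs2G G P R`. -/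
theorem klZs2G_base : (2 : ℝ) ^ 11 * Real.exp 1 ^ 18 * Real.sqrt (2 * (7 + 1606732)) ^ 4 * klE3A1 R ≤ klZs2G G P R :=
  (isGridLitPkg_klGridLitPkg P R (klEngQ7 P R) G).2.2.1

/-- **The producer's U-threshold at the keys `(klEngQ7 P R, G)`** (a successor-u-chain entry): `klGridLitUAtG G P R Q cc := klGridLitU P R (klEngQ7 P R) G Q cc`. -/
def klGridLitUAtG (Q : EngConsts) (cc : ℝ) : ℝ := klGridLitU P R (klEngQ7 P R) G Q cc

/-- `0 < klGridLitUAtG G P R Q cc`. -/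
theorem klGridLitUAtG_pos (Q : EngConsts) (cc : ℝ) : 0 < klGridLitUAtG G P R Q cc := klGridLitU_pos P R _ _ Q cc

/-- `klGridLitUAtG klEngGeo11 P R = klGridLitUAt P R` (`rfl`). -/
theorem klGridLitUAtG_klEngGeo11 : klGridLitUAtG klEngGeo11 P R = klGridLitUAt P R := rfl

/-- **The producer's c-threshold at the keys `(klEngQ7 P R, G)`** (a successor-c-chain entry of `klEngC₃7G`): `klGridLitCAtG G P R := klGridLitC P R (klEngQ7 P R) G`. -/
def klGridLitCAtG : ℝ := klGridLitC P R (klEngQ7 P R) G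

/-- `0 < klGridLitCAtG G P R`. -/
theorem klGridLitCAtG_pos : 0 < klGridLitCAtG G P R := klGridLitC_pos P R _ _

/-- `klGridLitCAtG klEngGeo11 P R = klGridLitCAt P R` (`rfl`). -/
theorem klGridLitCAtG_klEngGeo11 : klGridLitCAtG klEngGeo11 P R = klGridLitCAt P R := rfl

variable {G P R}

/-- **UNROLL AT THE KEYS `(klEngQ7 P R, G)`** — the (b) closer's fifth conjunct at the G-keyed docket literals from the producer's ∃-statement at `G`
(history `HistP klPredsV17F2 L M G …`). -/
theorem twoLegGridFlowMomentsAtC_klZG_of_exists {Q : EngConsts} {cc μ U β : ℝ} {L M : ℕ} [NeZero L] [NeZero M] {n : ℕ}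
    (hex : ∃ e : (ℝ × ℝ × ℝ) × (EngConsts → ℝ → ℝ) × ℝ, IsGridLitPkg R e ∧ TwoLegGridMomentsStepCT P R (klEngQ7 P R) G e.1 e.2.1 e.2.2)
    (hQ : (klEngQ7 P R).IsRaiseOf Q) (hc : 0 < cc) (hc36 : cc ≤ klEngC₃6 P R) (hcG : cc ≤ klGridLitCAtG G P R) (hμ : μ ∈ klWindowC) (hU : 0 < U)
    (hU10 : U ≤ klEngU₀10 P R cc)
    (hUu : U ≤ klGridLitUAtG G P R Q cc) (hβ : klBetaMin ≤ β) (hβc : β ≤ Real.exp (cc / U ^ 2)) (hL : klEngL₄ P R β U ≤ L) (hM : klEngM₃ β U L ≤ M)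
    (hn1 : 1 ≤ n) (hn : n ≤ nScales β + 1) (hhist : HistP klPredsV17F2 L M G P Q R β U μ 0 n) (hfr : FrameOK R U (nScales β) μ (klFlowFrameU L M β U μ n))
    (hN : KernelNormsV4 L M P Q β U μ (klFlowFrameU L M β U μ n) n)
    (hlev : ∀ j ≤ n, (KernelNormsLevels L M P Q β U μ (klFlowFrameU L M β U μ n) j ∧ KernelNormsWt4 L M (klWtBudget P Q U j) β U μ (klFlowFrameU L M β U μ n) j))
    (hlevU : ∀ j ≤ n, LevelsUExportMixedAt L M (klCU2 P R (klEngQ7 P R)) P β U μ j) :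
    TwoLegGridFlowMomentsAtC L M (klZtG G P R) (klZs1G G P R) (klZs2G G P R) cc β U μ n :=
  twoLegGridFlowMomentsAtC_pkg_of_exists P R hex hQ hc hc36 hcG hμ hU hU10 hUu hβ hβc hL hM hn1 hn hhist hfr hN hlev hlevU

end Literals

/-! ## §2 Token #28 at the geometry slot: `klEngC₃7G G P R` (D2‴'s chain with the two G-keyed entries re-keyed; `klTowerCC P R` of D1 is G-free) -/

section TokenC3

variable (G : GeoConsts) (P : SplitConsts) (R : RenConsts)

/-- **`klEngC₃7G G P R := min klEngC₃6 (min (R.cz·ln 4/(1200·(klZs1G+1))) (min (ln 4/(20·(klZs1G+1))) (min klTowerCC (min (klTowerCoreCC9G G) (klGridLitCAtG G)))))`** —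
token #28 of the v2 FREEZE docket re-keyed at the geometry slot `G`: (R60f)'s two rows on the G-keyed literal `klZs1G G P R`; AMENDMENT 23's tower c-slots `klTowerCC P R`
(D1, G-free) and `klTowerCoreCC9G G P R` (the capped core-C package deferred at `G`, `…TowerCoreDefsCG`); the grid producer's own threshold `klGridLitCAtG G P R`.  At
`G := klEngGeo11` this IS D2‴'s `klEngC₃7 P R` (`klEngC₃7G_klEngGeo11`, `rfl`). -/
def klEngC₃7G : ℝ :=
  min (klEngC₃6 P R) (min (R.cz * Real.log 4 / (1200 * (klZs1G G P R + 1))) (min (Real.log 4 / (20 * (klZs1G G P R + 1)))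
    (min (klTowerCC P R) (min (klTowerCoreCC9G G P R) (klGridLitCAtG G P R)))))

/-- **CONSISTENCY WITH THE FREEZE TEXT**: `klEngC₃7G klEngGeo11 P R = klEngC₃7 P R` (`rfl`). -/
theorem klEngC₃7G_klEngGeo11 : klEngC₃7G klEngGeo11 P R = klEngC₃7 P R := rfl

/-- THE #28 LIFT LINE at `G`: `klEngC₃7G G P R ≤ klEngC₃6 P R` (the image's `hc36`). -/
theorem klEngC₃7G_le_klEngC₃6 : klEngC₃7G G P R ≤ klEngC₃6 P R := min_le_left _ _

/-- `klEngC₃7G G P R ≤ R.cz·ln 4/(1200·(klZs1G G P R + 1))`. -/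
theorem klEngC₃7G_le_cz_row : klEngC₃7G G P R ≤ R.cz * Real.log 4 / (1200 * (klZs1G G P R + 1)) := (min_le_right _ _).trans (min_le_left _ _)

/-- `klEngC₃7G G P R ≤ ln 4/(20·(klZs1G G P R + 1))`. -/
theorem klEngC₃7G_le_log_row : klEngC₃7G G P R ≤ Real.log 4 / (20 * (klZs1G G P R + 1)) :=
  (min_le_right _ _).trans ((min_le_right _ _).trans (min_le_left _ _))

/-- AMENDMENT 23 row at `G`: `klEngC₃7G G P R ≤ klTowerCC P R` (D1's full c-slotted deliverable, G-free). -/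
theorem klEngC₃7G_le_klTowerCC : klEngC₃7G G P R ≤ klTowerCC P R :=
  (min_le_right _ _).trans ((min_le_right _ _).trans ((min_le_right _ _).trans (min_le_left _ _)))

/-- AMENDMENT 23 row at `G` (registrant (J3)/(J4)/(J5)): `klEngC₃7G G P R ≤ klTowerCoreCC9G G P R` — a stub-(b) closer under the G-keyed image feeds
`towerCoreC9G_at_klEngQ9c`'s `hcT` as `hc3.trans (klEngC₃7G_le_klTowerCoreCC9G G P R)`. -/
theorem klEngC₃7G_le_klTowerCoreCC9G : klEngC₃7G G P R ≤ klTowerCoreCC9G G P R :=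
  (min_le_right _ _).trans ((min_le_right _ _).trans ((min_le_right _ _).trans ((min_le_right _ _).trans (min_le_left _ _))))

/-- «(b)-C-SLOT-TWIN» row at `G`: `klEngC₃7G G P R ≤ klGridLitCAtG G P R` — the (b) closer feeds `twoLegGridFlowMomentsAtC_klZG_of_exists`'s `hcG` as
`hc3.trans (klEngC₃7G_le_klGridLitCAtG G P R)`. -/
theorem klEngC₃7G_le_klGridLitCAtG : klEngC₃7G G P R ≤ klGridLitCAtG G P R :=
  (min_le_right _ _).trans ((min_le_right _ _).trans ((min_le_right _ _).trans ((min_le_right _ _).trans (min_le_right _ _))))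

variable {R}

/-- `0 < klEngC₃7G G P R` under `R.WF2` (`0 < R.cz`; `0 ≤ klZs1G`; `0 < klTowerCC`, `0 < klTowerCoreCC9G`, `0 < klGridLitCAtG` unconditionally).  A G-keyed image's
witness line reads `klEngC₃7G_pos G P hR`. -/
theorem klEngC₃7G_pos (hR : R.WF2) : 0 < klEngC₃7G G P R := by
  have hcz : 0 < R.cz := hR.2.2
  have hZ : 0 < klZs1G G P R + 1 := by linarith [klZs1G_nonneg G P R]
  have hlog : 0 < Real.log 4 := Real.log_pos (by norm_num)
  exact lt_min (klEngC₃6_pos P R) (lt_min (by positivity) (lt_min (by positivity)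
    (lt_min (klTowerCC_pos P R) (lt_min (klTowerCoreCC9G_pos G P R) (klGridLitCAtG_pos G P R)))))

end TokenC3

/-! ## §3 The (e) closer's #28 row from the doors, at `G` -/

/-- **THE #28 ROW FROM THE DOORS at `G`**: `c ≤ klEngC₃7G G P R`, `0 < U ≤ 1`, `U ≤ R.cz/(1200·(klZs1G+1))`, `U ≤ 1/(20·(klZs1G+1))` ⇒
`klZs1G·(c/ln 4 + U²) ≤ min (cz/600) (1/10)` (`mixedRow_of_thresholds` on the opaque literal; the two U-rows are successor-u-chain entries). -/
theorem klZs1G_mixedRow_of_doors {G : GeoConsts} {P : SplitConsts} {R : RenConsts} {c U : ℝ} (hc : c ≤ klEngC₃7G G P R) (hU : 0 < U) (hU1 : U ≤ 1)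
    (hU2 : U ≤ R.cz / (1200 * (klZs1G G P R + 1))) (hU3 : U ≤ 1 / (20 * (klZs1G G P R + 1))) :
    klZs1G G P R * (c / Real.log 4 + U ^ 2) ≤ min (R.cz / 600) (1 / 10) :=
  mixedRow_of_thresholds (klZs1G_nonneg G P R) hU hU1 (hc.trans (klEngC₃7G_le_cz_row G P R)) (hc.trans (klEngC₃7G_le_log_row G P R)) hU2 hU3

end Summit.HubbardSuperconductivity.HubbardSuperconductivity.Theorems.EngineV8

end
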